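import Summits.RiemannHypothesis.RiemannHypothesis.Theses.RuelleBand
import Summits.RiemannHypothesis.RiemannHypothesis.Theorems.RuelleBandExactFirstBandStubHeatSummable
import Summits.RiemannHypothesis.RiemannHypothesis.Theorems.RuelleBandExactFirstBandStubHeatBounded
import Summits.RiemannHypothesis.RiemannHypothesis.Theorems.RuelleBandExactFirstBandStubTransfer
import Summits.RiemannHypothesis.RiemannHypothesis.Theorems.RuelleBandExactFirstBandStubExactHeatPD
import Summits.RiemannHypothesis.RiemannHypothesis.Theorems.RuelleBandExactFirstBandStubExpConvexDirichletRealAux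
import Summits.RiemannHypothesis.RiemannHypothesis.Theorems.RuelleBandExactFirstBandStubExpConvexDirichletReal
import Summits.RiemannHypothesis.RiemannHypothesis.Theorems.RuelleBandExactFirstBandStubLaplaceGeneratingFunction
import Summits.RiemannHypothesis.RiemannHypothesis.Theorems.RuelleBandExactFirstBandStubHeatConeIff
import Summits.RiemannHypothesis.RiemannHypothesis.Theorems.RuelleBandExactFirstBandStubGaussMellin
import Summits.RiemannHypothesis.RiemannHypothesis.Theorems.RuelleBandExactFirstBandStubArchLimit
import Summits.RiemannHypothesis.RiemannHypothesis.Theorems.RuelleBandExactFirstBandStubZeroSideLimit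
import Summits.RiemannHypothesis.RiemannHypothesis.Theorems.RuelleBandExactFirstBandStubPrimeLimit
import Summits.RiemannHypothesis.RiemannHypothesis.Theorems.RuelleBandExactFirstBandStubCutoffMellin
import Summits.RiemannHypothesis.RiemannHypothesis.Theorems.RuelleBandExactFirstBandStubGaussDecay
import Summits.RiemannHypothesis.RiemannHypothesis.Theorems.RuelleBandExactFirstBandStubWeilGaussPDRankOne
import Literature.NumberTheory.LFunctions.WeilZeroSum
import Literature.NumberTheory.LFunctions.WeilExplicitFormulaProofs
import Literature.Analysis.OperatorTheory.HalfLinePositiveDefiniteHolomorphic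
import Mathlib.Analysis.Calculus.BumpFunction.InnerProduct
import Mathlib.Analysis.SpecialFunctions.Gaussian.GaussianIntegral
import HarnessLib.Audit

/-!
# Line `Sketch` (heat cone) — skeleton for crux `RuelleBand.ExactFirstBand`
(item stmt-RiemannHypothesis-2061, route route-RiemannHypothesis-RuelleBand; line lead gen 1, cycle 2;
re-audited by lead c3, 2026-08-17: composition unchanged, ONE sorry = the bet `stub_weilGaussPD` ⟺ RiemannHypothesis
(`weilGaussPD_iff_riemannHypothesis`, p97617); NEW: its rank-one face is an unconditional THEOREM,
`stub_weilGaussPD_rank_one` / `heatTrace_re_pos` / `weilGauss_re_pos`, landed p137794 — see `### Rank one` below)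

Crux (FIXED, route decl): `ExactFirstBand : ∀ s, ζ s = 0 → 0 < re s → re s < 1 → re s = 1/2 ∨ im s = 0`
(RH-equivalent in tree, `Negative.exactFirstBand_iff_riemannHypothesis`).

## The line (unchanged composition, cycle 1 — lead -0)

Zero heat trace `Z(t) = Σ_ρ m(ρ) e^{-t ρ(1-ρ)}` over the non-trivial zeros.  ENGINE (landed, p89997): a
bounded-positive-definite (on `((0,∞),+)`) locally-finite Dirichlet series `Re Σ wᵢ e^{-tλᵢ}` has real
exponents; TRANSFER (p86455): applied to `Z` it gives `Im ρ(1-ρ) = 0` at every zero, i.e. X.  Hence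
`ExactFirstBand_of := transfer engine summable ⟨heatPD, bounded⟩`, and the single research input is
positive definiteness of the heat trace (`heatPD`; ⟺ X, p90503 `stub_heatCone_iff`).

## Cycle 2 (this file): the bet is moved PRIME-SIDE through the Gaussian explicit formula

With the Gaussian test `g_u(t) = (4πu)^{-1/2} e^{-t²/(4u)}` (tree normalisation
`weilMellin g s = ∫ g(t)e^{(s-1/2)t}dt`, so `ĝ_u(s) = e^{u(s-1/2)²}` and `ĝ_u(ρ) = e^{u/4}e^{-uρ(1-ρ)}`), the
Guinand–Weil explicit formula for `g_u` reads `Z(u) = e^{-u/4} · W(g_u)` (`weilFunctional`; disprover's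
pre-target `GaussianExplicitFormula`, numerically confirmed to 1e-23…1e-31 in the tree's normalisation,
kit j014946).  The tree proves the explicit formula for SMOOTH COMPACTLY SUPPORTED tests
(`explicit_formula_holds`, Bombieri 2000 Thm 2); this skeleton extends it to smooth tests with
`∫(|g|+|g'|+|g''|)e^{|t|/2} < ∞`, `|g| ≤ Ce^{-|t|}` (`explicit_formula_of_decay`) by CUT-OFF APPROXIMATION
`g_R = χ(·/R)·g` (triage-r1-2, sharpen (1)): uniform strip decay `|ĝ_R(s)| ≤ D/(1+Im²)` on `|Re s-1/2| ≤ 1/2`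
(two integrations by parts, `norm_weilMellin_le_of_abs_re_le`), dominated convergence on the zero side
(`Σ m(ρ)/(1+γ²) < ∞`, Jensen), on the archimedean integral (`|ψ| ≤ C + log(1+|t|)`), on the prime sum and on
the polar terms.  The bet becomes

  `stub_weilGaussPD`:  `u ↦ Re W(g_u)` is positive definite on `((0,∞),+)`

(= Weil positivity `W(G ⋆ G̃) ≥ 0` on the Gaussian cone `G = Σ c_a g_{s_a}`, since `g_u ⋆ g_v = g_{u+v}`,
`g̃_u = g_u`), which gives `heatPD` termwise (`Re Z(s_a+s_b) = e^{-s_a/4}e^{-s_b/4} Re W(g_{s_a+s_b})`).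
It is still EXACTLY X-strength (calibration `weilGaussPD_iff`, from p90503) — no hidden strengthening; its
only known mechanism is Weil positivity (⟺ RH, tree `weil_criterion_holds`).  No mechanism is claimed.

Registered stubs of THIS cycle (≤ 7) — STATUS after wave 1 (2026-08-16T10:40Z): SIX LANDED as `--supports` theorems
(`Theorems/RuelleBandExactFirstBandStub*.lean`), imported by name below, so the ONLY `sorry` left is THE BET:
`stub_cutoffMellin` (L, p96691: cut-off package — test-function property, uniform strip decay, pointwise
convergence of `ĝ_R`) · `stub_zeroSideLimit` (M, p96495: dominated convergence over the zeros) ·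
`stub_archLimit` (M, p96437: dominated convergence of the digamma integral) · `stub_primeLimit`
(S/M, p96519: the prime sum under cut-offs) · `stub_gaussDecay` (M, p96737: the Gaussian satisfies the hypotheses) ·
`stub_gaussMellin` (S, p96435: `ĝ_u(s) = e^{u(s-1/2)²}`) · `stub_weilGaussPD` (THE BET — open, RH-strength).
Consequently `explicit_formula_of_decay`, `gauss_explicit`, `heatTrace_eq` (the Gaussian explicit formula) and the
calibration `weilGaussPD_iff` (bet ⟺ X) below are UNCONDITIONAL theorems (landed copy:
`Theorems/RuelleBandExactFirstBandGaussExplicit.lean`).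
Landed stubs of cycle 1 are imported by name (no sorry): heatSummable p85981, heatBounded p87881, transfer
p86455, exact_heatPD p87151, laplaceGeneratingFunction p86289, dirichletSide p89531, expConvexDirichlet_real
p89997, heatCone_iff p90503.

Dictionary: zeros ↦ `ZetaZeros.riemannZetaNontrivialZeros`; `m(ρ)` ↦ `riemannZetaZeroOrder ρ`;
`Z(t)` ↦ `∑' ρ, (m ρ : ℂ) * cexp (-(t * (ρ * (1 - ρ))))`; `g_u` is written VERBATIM
`fun t : ℝ => ((Real.exp (-(t ^ 2) / (4 * u)) / Real.sqrt (4 * Real.pi * u) : ℝ) : ℂ)` (= `Ideator3.gaussTest u`,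
no local `def`, so every stub lands as a pure `--supports` theorem over existing declarations);
cut-off `χ : ContDiffBump (0 : ℝ)` (any), `g_R t = (χ (t / R) : ℂ) * g t`, `R → ∞` along `atTop : Filter ℝ`.

Negative lane honoured (`Cruxes/ExactFirstBand/Disproof.lean`, read 2026-08-16T10:20Z): §1 X ⟺ RH (the bet is
RH-strength and declared so); §2 only `ζ s = 0` is load-bearing — the explicit formula is where `ζ` (Euler
product: `weilPrimeTerm`; gamma factor: `weilArchTerm`) enters the line; §3 model shapes (DH quintic, Epstein)
have no Euler product, consistent with a prime-side bet; Targets: `GaussianExplicitFormula` "SURVIVES as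
typed … the lead may build on it" (j014946) — built on here; `HeatTraceBounded` cheap (landed p87881).
-/

set_option linter.dupNamespace false

noncomputable section

open Complex MeasureTheory Filter Set
open scoped BigOperators Topology ComplexConjugate ContDiff Real

namespace Summit.RiemannHypothesis.RiemannHypothesis.Cruxes.ExactFirstBand.HeatCone

open Summit.RiemannHypothesis.RiemannHypothesis.Theses.RuelleBand
open Literature.NumberTheory.LFunctions
open Literature.Analysis.OperatorTheory

/-! ### Cycle-1 stubs (all LANDED; imported by name, no sorry) -/

/-- **Stub 1 (S, landed p85981) — absolute summability of the heat trace.** -/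
theorem stub_heatSummable :
    ∀ t : ℝ, 0 < t → Summable (fun ρ : ZetaZeros.riemannZetaNontrivialZeros =>
      (riemannZetaZeroOrder (ρ : ℂ) : ℝ) * Real.exp (-(t * ((ρ : ℂ) * (1 - (ρ : ℂ))).re))) :=
  Summit.RiemannHypothesis.RiemannHypothesis.Theorems.RuelleBandExactFirstBand.stub_heatSummable

/-- **Stub 2 (S, landed p87881) — boundedness of `Re Z` on every `[t₀, ∞)`.** -/
theorem stub_heatBounded :
    ∀ t₀ : ℝ, 0 < t₀ → ∃ M : ℝ, ∀ t : ℝ, t₀ ≤ t →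
      |(∑' ρ : ZetaZeros.riemannZetaNontrivialZeros,
          (riemannZetaZeroOrder (ρ : ℂ) : ℂ) * cexp (-((t : ℂ) * ((ρ : ℂ) * (1 - (ρ : ℂ)))))).re| ≤ M :=
  Summit.RiemannHypothesis.RiemannHypothesis.Theorems.RuelleBandExactFirstBand.stub_heatBounded

/-- **Stub 3 (L, landed p89997) — THE ENGINE: an exponentially convex, locally finite Dirichlet series
has real exponents.** -/
theorem stub_expConvexDirichlet_real :
    ∀ (ι : Type) [Countable ι] (w : ι → ℝ) (l : ι → ℂ),
      (∀ i, 0 < w i) → (∀ i, 0 < (l i).re) → (∀ C : ℝ, {i | (l i).re ≤ C}.Finite) →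
      (∀ t : ℝ, 0 < t → Summable (fun i => w i * Real.exp (-(t * (l i).re)))) →
      IsBoundedHalfLinePD (fun t : ℝ => (∑' i, ((w i : ℝ) : ℂ) * cexp (-((t : ℂ) * l i))).re) →
      ∀ i, (l i).im = 0 :=
  Summit.RiemannHypothesis.RiemannHypothesis.Theorems.RuelleBandExactFirstBand.stub_expConvexDirichlet_real

/-- **Stub 4 (M, landed p86455) — transfer to `ζ`.** -/
theorem stub_transfer :
    (∀ (ι : Type) [Countable ι] (w : ι → ℝ) (l : ι → ℂ),
      (∀ i, 0 < w i) → (∀ i, 0 < (l i).re) → (∀ C : ℝ, {i | (l i).re ≤ C}.Finite) →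
      (∀ t : ℝ, 0 < t → Summable (fun i => w i * Real.exp (-(t * (l i).re)))) →
      IsBoundedHalfLinePD (fun t : ℝ => (∑' i, ((w i : ℝ) : ℂ) * cexp (-((t : ℂ) * l i))).re) →
      ∀ i, (l i).im = 0) →
    (∀ t : ℝ, 0 < t → Summable (fun ρ : ZetaZeros.riemannZetaNontrivialZeros =>
      (riemannZetaZeroOrder (ρ : ℂ) : ℝ) * Real.exp (-(t * ((ρ : ℂ) * (1 - (ρ : ℂ))).re)))) →
    IsBoundedHalfLinePD (fun t : ℝ => (∑' ρ : ZetaZeros.riemannZetaNontrivialZeros,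
      (riemannZetaZeroOrder (ρ : ℂ) : ℂ) * cexp (-((t : ℂ) * ((ρ : ℂ) * (1 - (ρ : ℂ)))))).re) →
    ∀ s : ℂ, riemannZeta s = 0 → 0 < s.re → s.re < 1 → s.re = 1 / 2 ∨ s.im = 0 :=
  Summit.RiemannHypothesis.RiemannHypothesis.Theorems.RuelleBandExactFirstBand.stub_transfer

/-- **Stub 6 (M, landed p87151) — calibration X ⟹ heat-cone positivity.** -/
theorem stub_exact_heatPD :
    (∀ t : ℝ, 0 < t → Summable (fun ρ : ZetaZeros.riemannZetaNontrivialZeros =>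
      (riemannZetaZeroOrder (ρ : ℂ) : ℝ) * Real.exp (-(t * ((ρ : ℂ) * (1 - (ρ : ℂ))).re)))) →
    ExactFirstBand →
    ∀ (n : ℕ) (s c : Fin n → ℝ), (∀ a, 0 < s a) →
      0 ≤ ∑ a, ∑ b, c a * c b *
        (∑' ρ : ZetaZeros.riemannZetaNontrivialZeros,
          (riemannZetaZeroOrder (ρ : ℂ) : ℂ) * cexp (-(((s a + s b : ℝ) : ℂ) * ((ρ : ℂ) * (1 - (ρ : ℂ)))))).re :=
  Summit.RiemannHypothesis.RiemannHypothesis.Theorems.RuelleBandExactFirstBand.stub_exact_heatPD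

/-- **Stub 9 (S, landed p90503) — heat-cone positivity ⟺ X.** -/
theorem stub_heatCone_iff :
    (∀ (n : ℕ) (s c : Fin n → ℝ), (∀ a, 0 < s a) →
      0 ≤ ∑ a, ∑ b, c a * c b *
        (∑' ρ : ZetaZeros.riemannZetaNontrivialZeros,
          (riemannZetaZeroOrder (ρ : ℂ) : ℂ) *
            cexp (-(((s a + s b : ℝ) : ℂ) * ((ρ : ℂ) * (1 - (ρ : ℂ)))))).re) ↔
    (∀ s : ℂ, riemannZeta s = 0 → 0 < s.re → s.re < 1 → s.re = 1 / 2 ∨ s.im = 0) :=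
  Summit.RiemannHypothesis.RiemannHypothesis.Theorems.RuelleBandExactFirstBand.stub_heatCone_iff

/-! ### Cycle-2 registered stubs (sorries ONLY here) -/

/-- **Stub A (L, LANDED p96691) — the cut-off package.** For a smooth `g` with `∫ (|g|+|g'|+|g''|) e^{|t|/2} < ∞` and any
smooth bump `χ` (`= 1` near `0`), the cut-offs `g_R = χ(·/R)·g` are Weil test functions; their transforms
obey the UNIFORM strip bound `|ĝ_R(s)| ≤ D/(1+(Im s)²)` for `R ≥ 1`, `|Re s - 1/2| ≤ 1/2` (two integrations
by parts: tree `norm_weilMellin_le_of_abs_re_le` gives `weilDecayW (1/2) g_R/(1+Im²)`, and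
`(χ_R g)'' = χ_R''g + 2χ_R'g' + χ_R g''` with `|χ^{(j)}(t/R)|/R^j ≤ sup|χ^{(j)}|` bounds `weilDecayW (1/2) g_R`
by `D = Σ_j M_j ∫|g^{(2-j)}|e^{|t|/2}`); and `ĝ_R(s) → ĝ(s)` pointwise there (dominated convergence,
dominator `|g(t)|e^{|t|/2}`, `χ(t/R) → χ(0) = 1`). [folklore; Bombieri 2000 §2] -/
theorem stub_cutoffMellin :
    ∀ (χ : ContDiffBump (0 : ℝ)) (g : ℝ → ℂ), ContDiff ℝ ∞ g →
      Integrable (fun t : ℝ => ‖g t‖ * Real.exp (|t| / 2)) →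
      Integrable (fun t : ℝ => ‖deriv g t‖ * Real.exp (|t| / 2)) →
      Integrable (fun t : ℝ => ‖deriv (deriv g) t‖ * Real.exp (|t| / 2)) →
      (∀ R : ℝ, 0 < R → IsWeilTest (fun t : ℝ => (χ (t / R) : ℂ) * g t)) ∧
      (∃ D : ℝ, ∀ R : ℝ, 1 ≤ R → ∀ s : ℂ, |s.re - 1 / 2| ≤ 1 / 2 →
          ‖weilMellin (fun t : ℝ => (χ (t / R) : ℂ) * g t) s‖ ≤ D / (1 + s.im ^ 2)) ∧
      (∀ s : ℂ, |s.re - 1 / 2| ≤ 1 / 2 →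
          Tendsto (fun R : ℝ => weilMellin (fun t : ℝ => (χ (t / R) : ℂ) * g t) s) atTop
            (𝓝 (weilMellin g s))) :=
  -- LANDED p96691 (wave 1)
  Summit.RiemannHypothesis.RiemannHypothesis.Theorems.RuelleBandExactFirstBand.stub_cutoffMellin

/-- **Stub B (M, LANDED p96495) — dominated convergence on the zero side (abstract family).** If `F R ρ` is bounded by
`D/(1+γ²)` uniformly in `R ≥ 1` on the non-trivial zeros and converges pointwise to `F∞ ρ`, then
`Σ_ρ m(ρ) F R ρ → Σ_ρ m(ρ) F∞ ρ` and the limit is absolutely summable.  Input: `Σ_ρ m(ρ)/(1+γ²) < ∞`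
(zeros with `Re ρ ≥ 1/4`: `Σ m/|ρ|² < ∞` by Jensen, tree `summable_zeroOrder_div_norm_sq`, and
`|ρ|² ≤ 1+γ²`; zeros with `Re ρ < 1/4`: reflect by `ρ ↦ 1-ρ̄`, `riemannZetaZeroOrder_one_sub_conj` — the proof
of `weilZeroSummable` with one power less), then `tendsto_tsum_of_dominated_convergence`. [folklore] -/
theorem stub_zeroSideLimit :
    ∀ (F : ℝ → ℂ → ℂ) (Finf : ℂ → ℂ) (D : ℝ),
      (∀ R : ℝ, 1 ≤ R → ∀ ρ ∈ ZetaZeros.riemannZetaNontrivialZeros, ‖F R ρ‖ ≤ D / (1 + ρ.im ^ 2)) →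
      (∀ ρ ∈ ZetaZeros.riemannZetaNontrivialZeros, Tendsto (fun R : ℝ => F R ρ) atTop (𝓝 (Finf ρ))) →
      Summable (fun ρ : ZetaZeros.riemannZetaNontrivialZeros =>
          ‖(riemannZetaZeroOrder (ρ : ℂ) : ℂ) * Finf ρ‖) ∧
        Tendsto (fun R : ℝ => ∑' ρ : ZetaZeros.riemannZetaNontrivialZeros,
            (riemannZetaZeroOrder (ρ : ℂ) : ℂ) * F R ρ) atTop
          (𝓝 (∑' ρ : ZetaZeros.riemannZetaNontrivialZeros, (riemannZetaZeroOrder (ρ : ℂ) : ℂ) * Finf ρ)) :=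
  -- LANDED p96495 (wave 1)
  Summit.RiemannHypothesis.RiemannHypothesis.Theorems.RuelleBandExactFirstBand.stub_zeroSideLimit

/-- **Stub C (M, LANDED p96437) — dominated convergence of the archimedean integral (abstract family).** If `F R` are
continuous, `|F R t| ≤ D/(1+t²)` uniformly in `R ≥ 1`, and `F R t → F∞ t` pointwise, then
`∫ F R t · Re ψ(1/4 + it/2) dt → ∫ F∞ t · Re ψ(1/4 + it/2) dt`: dominator `D(C + log(1+|t|))/(1+t²)`
(`Literature.Analysis.SpecialFunctions.Complex.exists_norm_digamma_vertical_le` at `a = 1/4`;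
`log(1+|t|) ≤ √|t|`), `ψ` continuous on `Re > 0` (`continuousOn_digamma`),
`tendsto_integral_filter_of_dominated_convergence`. [folklore] -/
theorem stub_archLimit :
    ∀ (F : ℝ → ℝ → ℂ) (Finf : ℝ → ℂ) (D : ℝ),
      (∀ R : ℝ, 1 ≤ R → Continuous (F R)) →
      (∀ R : ℝ, 1 ≤ R → ∀ t : ℝ, ‖F R t‖ ≤ D / (1 + t ^ 2)) →
      (∀ t : ℝ, Tendsto (fun R : ℝ => F R t) atTop (𝓝 (Finf t))) →
      Tendsto (fun R : ℝ => ∫ t : ℝ, F R t * ((Complex.digamma (1 / 4 + t / 2 * I)).re : ℂ)) atTop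
        (𝓝 (∫ t : ℝ, Finf t * ((Complex.digamma (1 / 4 + t / 2 * I)).re : ℂ))) :=
  -- LANDED p96437 (wave 1)
  Summit.RiemannHypothesis.RiemannHypothesis.Theorems.RuelleBandExactFirstBand.stub_archLimit

/-- **Stub D (S/M, LANDED p96519) — the prime sum under cut-offs.** For continuous `g` with `|g(t)| ≤ Ce^{-|t|}` the prime
term `Σ Λ(n) n^{-1/2}(g_R(log n) + g_R(-log n))` of `g_R = χ(·/R)·g` tends to that of `g`: dominated
convergence over `ℕ` (`tendsto_tsum_of_dominated_convergence`), dominator `2C Λ(n) n^{-3/2}` (`|χ| ≤ 1`,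
`e^{-|log n|} = 1/n`; summable since `Λ(n) ≤ log n ≤ 4n^{1/4}`, or `LSeriesSummable` of `Λ` at `3/2`),
termwise `χ(±log n/R) → χ(0) = 1`. [folklore] -/
theorem stub_primeLimit :
    ∀ (χ : ContDiffBump (0 : ℝ)) (g : ℝ → ℂ), Continuous g →
      (∃ C : ℝ, ∀ t : ℝ, ‖g t‖ ≤ C * Real.exp (-|t|)) →
      Tendsto (fun R : ℝ => weilPrimeTerm (fun t : ℝ => (χ (t / R) : ℂ) * g t)) atTop
        (𝓝 (weilPrimeTerm g)) :=
  -- LANDED p96519 (wave 1)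
  Summit.RiemannHypothesis.RiemannHypothesis.Theorems.RuelleBandExactFirstBand.stub_primeLimit

/-- **Stub E (M, LANDED p96737) — the Gaussian satisfies the hypotheses.** `g_u(t) = (4πu)^{-1/2}e^{-t²/(4u)}` is smooth,
`g_u' = -(t/2u)g_u`, `g_u'' = (t²/4u² - 1/2u)g_u`, and `|t|^k e^{-t²/(4u)} e^{|t|/2}` is integrable
(`e^{-t²/(4u)+|t|/2} ≤ e^{u}e^{-t²/(8u)}`-type completion of the square; Mathlib Gaussian integrability
`integrable_exp_neg_mul_sq`, `integrable_rpow_mul_exp_neg_mul_sq`); `|g_u(t)| ≤ (4πu)^{-1/2}e^{u}e^{-|t|}`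
(`t²/(4u) + u ≥ |t|`). [folklore] -/
theorem stub_gaussDecay :
    ∀ u : ℝ, 0 < u →
      ContDiff ℝ ∞ (fun t : ℝ => ((Real.exp (-(t ^ 2) / (4 * u)) / Real.sqrt (4 * Real.pi * u) : ℝ) : ℂ)) ∧
      Integrable (fun t : ℝ =>
        ‖(fun t : ℝ => ((Real.exp (-(t ^ 2) / (4 * u)) / Real.sqrt (4 * Real.pi * u) : ℝ) : ℂ)) t‖ *
          Real.exp (|t| / 2)) ∧
      Integrable (fun t : ℝ =>
        ‖deriv (fun t : ℝ => ((Real.exp (-(t ^ 2) / (4 * u)) / Real.sqrt (4 * Real.pi * u) : ℝ) : ℂ)) t‖ *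
          Real.exp (|t| / 2)) ∧
      Integrable (fun t : ℝ =>
        ‖deriv (deriv (fun t : ℝ =>
            ((Real.exp (-(t ^ 2) / (4 * u)) / Real.sqrt (4 * Real.pi * u) : ℝ) : ℂ))) t‖ *
          Real.exp (|t| / 2)) ∧
      ∃ C : ℝ, ∀ t : ℝ,
        ‖(fun t : ℝ => ((Real.exp (-(t ^ 2) / (4 * u)) / Real.sqrt (4 * Real.pi * u) : ℝ) : ℂ)) t‖ ≤
          C * Real.exp (-|t|) :=
  -- LANDED p96737 (wave 1)
  Summit.RiemannHypothesis.RiemannHypothesis.Theorems.RuelleBandExactFirstBand.stub_gaussDecay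

/-- **Stub F (S, LANDED p96435) — the Mellin–Laplace transform of the Gaussian**: `ĝ_u(s) = e^{u(s-1/2)²}` for every
`s ∈ ℂ` (complete the square; Mathlib `integral_cexp_quadratic` with `b = -1/(4u)`, `c = s - 1/2`, `d = 0`,
and `(π/(1/(4u)))^{1/2} = √(4πu)`). [folklore] -/
theorem stub_gaussMellin :
    ∀ u : ℝ, 0 < u → ∀ s : ℂ,
      weilMellin (fun t : ℝ => ((Real.exp (-(t ^ 2) / (4 * u)) / Real.sqrt (4 * Real.pi * u) : ℝ) : ℂ)) s =
        cexp ((u : ℂ) * (s - 1 / 2) ^ 2) :=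
  -- LANDED p96435 (wave 1)
  Summit.RiemannHypothesis.RiemannHypothesis.Theorems.RuelleBandExactFirstBand.stub_gaussMellin

/-- **Stub G — THE BET `C⁺`, prime-side form (RH-strength; ⟺ X by `weilGaussPD_iff`).** The Weil
functional is positive definite on the Gaussian semigroup: for all `s_a > 0` and real `c_a`,
`Σ_{a,b} c_a c_b Re W(g_{s_a+s_b}) ≥ 0`, where `W = weilFunctional` (polar − prime + archimedean terms of the
explicit formula) and `g_u(t) = (4πu)^{-1/2}e^{-t²/(4u)}`.  Since `g_u ⋆ g_v = g_{u+v}` and `g̃_u = g_u` this is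
Weil positivity `W(G ⋆ G̃) ≥ 0` on the real cone `G = Σ_a c_a g_{s_a}` — implied by `WeilPositivity` (⟺ RH,
`weil_criterion_holds`); no mechanism is offered for it here. -/
theorem stub_weilGaussPD :
    ∀ (n : ℕ) (s c : Fin n → ℝ), (∀ a, 0 < s a) →
      0 ≤ ∑ a, ∑ b, c a * c b *
        (weilFunctional (fun t : ℝ =>
          ((Real.exp (-(t ^ 2) / (4 * (s a + s b))) / Real.sqrt (4 * Real.pi * (s a + s b)) : ℝ) : ℂ))).re := by
  sorry

/-! ### Glue (kernel-checked modulo the stubs) -/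

/-- **The Guinand–Weil explicit formula for smooth rapidly decaying test functions** (absolutely
convergent form): if `g` is smooth, `∫(|g|+|g'|+|g''|)e^{|t|/2} < ∞` and `|g(t)| ≤ Ce^{-|t|}`, then
`Σ_ρ m(ρ) ĝ(ρ)` converges absolutely over the non-trivial zeros and equals `W(g)`.  Cut-off approximation
of the tree's `explicit_formula_holds` (stubs A–D). [cite: Bombieri2000Weil, §2 Thm 2; Weil 1952] -/
theorem explicit_formula_of_decay (χ : ContDiffBump (0 : ℝ)) {g : ℝ → ℂ} (hg : ContDiff ℝ ∞ g)
    (h0 : Integrable (fun t : ℝ => ‖g t‖ * Real.exp (|t| / 2)))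
    (h1 : Integrable (fun t : ℝ => ‖deriv g t‖ * Real.exp (|t| / 2)))
    (h2 : Integrable (fun t : ℝ => ‖deriv (deriv g) t‖ * Real.exp (|t| / 2)))
    (hdec : ∃ C : ℝ, ∀ t : ℝ, ‖g t‖ ≤ C * Real.exp (-|t|)) :
    Summable (fun ρ : ZetaZeros.riemannZetaNontrivialZeros =>
        ‖(riemannZetaZeroOrder (ρ : ℂ) : ℂ) * weilMellin g ρ‖) ∧
      ∑' ρ : ZetaZeros.riemannZetaNontrivialZeros, (riemannZetaZeroOrder (ρ : ℂ) : ℂ) * weilMellin g ρ =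
        weilFunctional g := by
  obtain ⟨hWT, ⟨D, hD⟩, hpt⟩ := stub_cutoffMellin χ g hg h0 h1 h2
  set gR : ℝ → ℝ → ℂ := fun R t => (χ (t / R) : ℂ) * g t with hgR_def
  -- the explicit formula at each level `R > 0` (tree), in absolutely convergent form
  have hEF : ∀ R : ℝ, 0 < R →
      ∑' ρ : ZetaZeros.riemannZetaNontrivialZeros, (riemannZetaZeroOrder (ρ : ℂ) : ℂ) * weilMellin (gR R) ρ =
        weilFunctional (gR R) := fun R hR =>
    tendsto_nhds_unique (hasWeilZeroSide_tsum (summable_norm_zeroSide (hWT R hR)))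
      (explicit_formula_holds (hWT R hR))
  -- the zero side
  have hstrip : ∀ ρ ∈ ZetaZeros.riemannZetaNontrivialZeros, |ρ.re - 1 / 2| ≤ 1 / 2 := fun ρ hρ =>
    abs_le.2 ⟨by linarith [ZetaZeros.riemannZetaNontrivialZeros.re_pos hρ],
      by linarith [ZetaZeros.riemannZetaNontrivialZeros.re_lt_one hρ]⟩
  obtain ⟨hsum, hzero⟩ := stub_zeroSideLimit (fun R ρ => weilMellin (gR R) ρ) (weilMellin g) D
    (fun R hR ρ hρ => hD R hR ρ (hstrip ρ hρ)) (fun ρ hρ => hpt ρ (hstrip ρ hρ))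
  -- the Weil side
  have hW : Tendsto (fun R => weilFunctional (gR R)) atTop (𝓝 (weilFunctional g)) := by
    have hp0 : Tendsto (fun R => weilMellin (gR R) 0) atTop (𝓝 (weilMellin g 0)) := hpt 0 (by norm_num)
    have hp1 : Tendsto (fun R => weilMellin (gR R) 1) atTop (𝓝 (weilMellin g 1)) := hpt 1 (by norm_num)
    have hprime : Tendsto (fun R => weilPrimeTerm (gR R)) atTop (𝓝 (weilPrimeTerm g)) :=
      stub_primeLimit χ g hg.continuous hdec
    have harch : Tendsto (fun R => weilArchIntegral (gR R)) atTop (𝓝 (weilArchIntegral g)) := by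
      refine stub_archLimit (fun R t => weilMellin (gR R) (1 / 2 + t * I))
        (fun t => weilMellin g (1 / 2 + t * I)) D ?_ ?_ ?_
      · intro R hR
        exact (continuous_weilMellin (hWT R (by linarith)).1.continuous (hWT R (by linarith)).2).comp
          (by fun_prop)
      · intro R hR t
        have h := hD R hR (1 / 2 + t * I) (by simp)
        simpa using h
      · intro t
        exact hpt (1 / 2 + t * I) (by simp)
    have h0R : ∀ R : ℝ, gR R 0 = g 0 := fun R => by
      simp [hgR_def, χ.one_of_mem_closedBall (Metric.mem_closedBall_self χ.rIn_pos.le)]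
    simp only [weilFunctional, weilPolarTerm, weilArchTerm, h0R]
    exact ((hp0.add hp1).sub hprime).add ((harch.const_mul _).sub tendsto_const_nhds)
  -- uniqueness of limits
  refine ⟨hsum, tendsto_nhds_unique hzero ?_⟩
  exact hW.congr' ((eventually_gt_atTop 0).mono fun R hR => (hEF R hR).symm)

/-- A fixed bump (`= 1` on `[-1,1]`, supported in `(-2,2)`). -/
def bump : ContDiffBump (0 : ℝ) := ⟨1, 2, one_pos, one_lt_two⟩

/-- **The Gaussian explicit formula (Mellin form)**: `Σ_ρ m(ρ) ĝ_u(ρ) = W(g_u)`, absolutely convergent. -/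
theorem gauss_explicit (u : ℝ) (hu : 0 < u) :
    Summable (fun ρ : ZetaZeros.riemannZetaNontrivialZeros =>
        ‖(riemannZetaZeroOrder (ρ : ℂ) : ℂ) *
          weilMellin (fun t : ℝ => ((Real.exp (-(t ^ 2) / (4 * u)) / Real.sqrt (4 * Real.pi * u) : ℝ) : ℂ)) ρ‖) ∧
      ∑' ρ : ZetaZeros.riemannZetaNontrivialZeros, (riemannZetaZeroOrder (ρ : ℂ) : ℂ) *
          weilMellin (fun t : ℝ => ((Real.exp (-(t ^ 2) / (4 * u)) / Real.sqrt (4 * Real.pi * u) : ℝ) : ℂ)) ρ =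
        weilFunctional
          (fun t : ℝ => ((Real.exp (-(t ^ 2) / (4 * u)) / Real.sqrt (4 * Real.pi * u) : ℝ) : ℂ)) := by
  obtain ⟨hC, h0, h1, h2, hdec⟩ := stub_gaussDecay u hu
  exact explicit_formula_of_decay bump hC h0 h1 h2 hdec

/-- **The Gaussian explicit formula (heat-trace form)**: for `u > 0`,
`Z(u) = Σ_ρ m(ρ) e^{-uρ(1-ρ)} = e^{-u/4} · W(g_u)` (disprover's `GaussianExplicitFormula`, kit j014946). -/
theorem heatTrace_eq (u : ℝ) (hu : 0 < u) :
    ∑' ρ : ZetaZeros.riemannZetaNontrivialZeros,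
        (riemannZetaZeroOrder (ρ : ℂ) : ℂ) * cexp (-((u : ℂ) * ((ρ : ℂ) * (1 - (ρ : ℂ))))) =
      cexp (-(u : ℂ) / 4) *
        weilFunctional
          (fun t : ℝ => ((Real.exp (-(t ^ 2) / (4 * u)) / Real.sqrt (4 * Real.pi * u) : ℝ) : ℂ)) := by
  rw [← (gauss_explicit u hu).2, ← tsum_mul_left]
  refine tsum_congr fun ρ => ?_
  rw [stub_gaussMellin u hu,
    show cexp (-(u : ℂ) / 4) * ((riemannZetaZeroOrder (ρ : ℂ) : ℂ) * cexp ((u : ℂ) * ((ρ : ℂ) - 1 / 2) ^ 2)) =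
        (riemannZetaZeroOrder (ρ : ℂ) : ℂ) * (cexp (-(u : ℂ) / 4) * cexp ((u : ℂ) * ((ρ : ℂ) - 1 / 2) ^ 2)) by
      ring,
    ← Complex.exp_add]
  exact congrArg _ (congrArg _ (by ring))

/-- **Heat-cone positivity from the prime-side bet** (cycle 1's `stub_heatPD`, now DERIVED):
`Re Z(s_a+s_b) = e^{-s_a/4} e^{-s_b/4} Re W(g_{s_a+s_b})`, so the heat form with coefficients `c_a` is the
Weil–Gauss form with coefficients `c_a e^{-s_a/4}`. -/
theorem heatPD :
    ∀ (n : ℕ) (s c : Fin n → ℝ), (∀ a, 0 < s a) →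
      0 ≤ ∑ a, ∑ b, c a * c b *
        (∑' ρ : ZetaZeros.riemannZetaNontrivialZeros,
          (riemannZetaZeroOrder (ρ : ℂ) : ℂ) * cexp (-(((s a + s b : ℝ) : ℂ) * ((ρ : ℂ) * (1 - (ρ : ℂ)))))).re := by
  intro n s c hs
  have key : ∀ a b,
      (∑' ρ : ZetaZeros.riemannZetaNontrivialZeros,
          (riemannZetaZeroOrder (ρ : ℂ) : ℂ) * cexp (-(((s a + s b : ℝ) : ℂ) * ((ρ : ℂ) * (1 - (ρ : ℂ)))))).re =
        Real.exp (-(s a) / 4) * Real.exp (-(s b) / 4) *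
          (weilFunctional (fun t : ℝ =>
            ((Real.exp (-(t ^ 2) / (4 * (s a + s b))) / Real.sqrt (4 * Real.pi * (s a + s b)) : ℝ) : ℂ))).re := by
    intro a b
    rw [heatTrace_eq (s a + s b) (add_pos (hs a) (hs b)), ← Real.exp_add,
      show -((s a + s b : ℝ) : ℂ) / 4 = ((-(s a) / 4 + -(s b) / 4 : ℝ) : ℂ) by push_cast; ring,
      ← Complex.ofReal_exp, Complex.re_ofReal_mul]
  simp_rw [key]
  have h := stub_weilGaussPD n s (fun a => c a * Real.exp (-(s a) / 4)) hs
  refine le_of_le_of_eq h (Finset.sum_congr rfl fun a _ => Finset.sum_congr rfl fun b _ => ?_)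
  ring

/-- **Calibration / honesty: the prime-side bet is EXACTLY the crux** (unfolded): `stub_weilGaussPD ⟺ X`.
`→`: `heatPD` + `stub_heatCone_iff` (p90503). `←`: X ⟹ heat-cone positivity (p87151) and
`Re W(g_u) = e^{u/4} Re Z(u)` reverses the change of coefficients. -/
theorem weilGaussPD_iff :
    (∀ (n : ℕ) (s c : Fin n → ℝ), (∀ a, 0 < s a) →
      0 ≤ ∑ a, ∑ b, c a * c b *
        (weilFunctional (fun t : ℝ =>
          ((Real.exp (-(t ^ 2) / (4 * (s a + s b))) / Real.sqrt (4 * Real.pi * (s a + s b)) : ℝ) : ℂ))).re) ↔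
    (∀ s : ℂ, riemannZeta s = 0 → 0 < s.re → s.re < 1 → s.re = 1 / 2 ∨ s.im = 0) := by
  constructor
  · intro _h
    exact stub_heatCone_iff.1 heatPD
  · intro hX n s c hs
    have hPD := stub_exact_heatPD stub_heatSummable hX n s (fun a => c a * Real.exp (s a / 4)) hs
    have key : ∀ a b,
        (weilFunctional (fun t : ℝ =>
            ((Real.exp (-(t ^ 2) / (4 * (s a + s b))) / Real.sqrt (4 * Real.pi * (s a + s b)) : ℝ) : ℂ))).re =
          Real.exp (s a / 4) * Real.exp (s b / 4) *
            (∑' ρ : ZetaZeros.riemannZetaNontrivialZeros,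
              (riemannZetaZeroOrder (ρ : ℂ) : ℂ) *
                cexp (-(((s a + s b : ℝ) : ℂ) * ((ρ : ℂ) * (1 - (ρ : ℂ)))))).re := by
      intro a b
      rw [heatTrace_eq (s a + s b) (add_pos (hs a) (hs b)), ← Real.exp_add,
        show -((s a + s b : ℝ) : ℂ) / 4 = ((-(s a) / 4 + -(s b) / 4 : ℝ) : ℂ) by push_cast; ring,
        ← Complex.ofReal_exp, Complex.re_ofReal_mul, ← mul_assoc, ← Real.exp_add,
        show s a / 4 + s b / 4 + (-(s a) / 4 + -(s b) / 4) = 0 by ring, Real.exp_zero, one_mul]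
    simp_rw [key]
    refine le_of_le_of_eq hPD (Finset.sum_congr rfl fun a _ => Finset.sum_congr rfl fun b _ => ?_)
    ring

/-! ### Rank one (LANDED p137794, lead c3): the diagonal of the bet is unconditional

`0 < Re Z(u)` and `0 < Re W(g_u)` for every `u > 0` — Weil's functional is positive at every single centred
Gaussian `g_u = g_{u/2} ⋆ g̃_{u/2}`, with no hypothesis (RH up to height 101, kernel-only; a certified on-line zero
below 33; explicit far-zero tail).  Hence the RH content of `stub_weilGaussPD` lives entirely in rank `≥ 2`
(the mixed terms / the moment problem `n → ∞`). -/

/-- **Registered stub `stub_weilGaussPD_rank_one` (LANDED p137794)** — the bet at `n = 1`, unconditionally. -/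
theorem stub_weilGaussPD_rank_one :
    ∀ (s c : Fin 1 → ℝ), (∀ a, 0 < s a) →
      0 ≤ ∑ a, ∑ b, c a * c b *
        (weilFunctional (fun t : ℝ =>
          ((Real.exp (-(t ^ 2) / (4 * (s a + s b))) / Real.sqrt (4 * Real.pi * (s a + s b)) : ℝ) : ℂ))).re :=
  Summit.RiemannHypothesis.RiemannHypothesis.Theorems.RuelleBandExactFirstBand.stub_weilGaussPD_rank_one

/-- **The zero heat trace is positive (unconditionally, LANDED p137794)**: `0 < Re Z(u)` for `u > 0`. -/
theorem heatTrace_re_pos (u : ℝ) (hu : 0 < u) :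
    0 < (∑' ρ : ZetaZeros.riemannZetaNontrivialZeros,
      (riemannZetaZeroOrder (ρ : ℂ) : ℂ) * cexp (-((u : ℂ) * ((ρ : ℂ) * (1 - (ρ : ℂ)))))).re :=
  Summit.RiemannHypothesis.RiemannHypothesis.Theorems.RuelleBandExactFirstBand.heatTrace_re_pos u hu

/-! ### The composition (kernel-checked modulo the stubs) -/

/-- **The line closes the crux modulo its stubs**: engine (p89997) + transfer (p86455) applied to
summability (p85981) and the bounded-positive-definite package ⟨`heatPD` (from the bet, stub G, through the
Gaussian explicit formula, stubs A–F), boundedness (p87881)⟩. -/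
theorem ExactFirstBand_of : ExactFirstBand :=
  stub_transfer stub_expConvexDirichlet_real stub_heatSummable ⟨heatPD, stub_heatBounded⟩

end Summit.RiemannHypothesis.RiemannHypothesis.Cruxes.ExactFirstBand.HeatCone

end
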